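import Literature.MeasureTheory.Group.OrbitalDescentContinuous      -- ★ p850135 D2 (F0P3a-p08 (g22)): `continuous_integral_conj_subtype`, `exists_descended_forall_orbitalIntegral_eq`; brings ★ `OrbitalDescentCentralizer`, ★ `OrbitalDescentFunction`, ★ `ConjugationCutoff`
import HarnessLib

/-!
# Harish-Chandra's descent keeps NON-NEGATIVITY, and the descended function is POSITIVE at a central point where the test function is
# (Rogawski 1990 §4.12 Lemma 4.12.1; Harish-Chandra–van Dijk 1970 Part I §3 Lemmas 19–23) — the positivity handle for (NONDEG-G′)

Topic `MeasureTheory/Group`; namespace `Literature.MeasureTheory.Group` (SIBLING of ★ D2 `OrbitalDescentContinuous`, which is imported and left untouched).  THEOREMS ONLY (no definition,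
no instance, no notation, no axiom, no named fact, no `sorry`).  GENERIC topology ∕ measure theory on a locally compact group.  Cell `pub/hodgecm-mathlib`, crux H413
(`stmt-HodgeConjecture-24833`), F0∕P3c line LH3 (closer stub `stub_N9`, organ J), brick **(NONDEG-G′)** (LH3-plan (g3) RULINGS 2026-09-02T07:46:17Z → F0P3b-p01 (g15)); census
07:50Z (c2)–(c5): ★ D2 `exists_descended_forall_orbitalIntegral_eq` hides Harish-Chandra's cut-off `β` behind `∃ ψ_M` and exports only «continuous, compactly supported, and the
descent identity», so a consumer that descends a NON-NEGATIVE test function `ψ` cannot see that `ψ_M ≥ 0`, nor that `ψ_M` is non-zero anywhere.  This file re-runs D2's five-line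
existence proof with the SAME ingredients (★ `exists_continuous_hasCompactSupport_integral_comp_mul_eq_one`, ★ `orbitalIntegral_eq_orbitalIntegral_descended`) and exports the two
extra facts the positivity of the Cayley limit needs.

THE MATHEMATICS.  `ψ_M(m) = ∫_G β(x) • ψ(x m x⁻¹) dν(x)` with `β ∈ C_c(G)`, `β ≥ 0`, `∫_M β(c k₀ h) dν_M(h) = 1` for `c ∈ C`, `k₀ ∈ M`.
* §1 `re_integral_conj_nonneg`, `im_integral_conj_eq_zero`: if `β ≥ 0` and `ψ` is REAL NON-NEGATIVE (`0 ≤ re ψ`, `im ψ = 0` — the currency of ★ (N1′)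
  `exists_archSmooth_nonneg_ne_zero_at`), then so is `ψ_M` (the integrand is pointwise real non-negative; `re`∕`im` commute with the Bochner integral).
* §2 `re_integral_conj_pos_of_forall_comm`: if moreover `m` is CENTRAL in `M` (`h m = m h` for all `h ∈ M` — the semi-regular wall point `s`, `M = Z(s)`), `0 < re ψ(m)`, and `β`
  is positive at ONE point `h₀ ∈ M`, then `0 < re ψ_M(m)`: the integrand `x ↦ β(x)·re ψ(x m x⁻¹)` is continuous, `≥ 0`, compactly supported and positive at `x = h₀`
  (`h₀ m h₀⁻¹ = m`), and a Haar measure charges open sets (Mathlib `Continuous.integral_pos_of_hasCompactSupport_nonneg_nonzero`).  NO CIRCULARITY: `ψ` is fixed before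
  `β`; centrality of `m` makes the location of `β`'s mass irrelevant.
* §3 **`exists_descended_forall_orbitalIntegral_eq_nonneg`** = ★ D2's statement VERBATIM (same binders, same identity clause) ∧ (iv) non-negativity transfer ∧ (v) positivity at
  central points: run the cut-off lemma with `C′ := insert 1 C` (enlarging `C` keeps the support hypothesis `hCM`), so that unit mass on the coset `1·M = M` yields `h₀ ∈ M`
  with `0 < β h₀` (`β ≥ 0`, `∫_M β = 1`).  A consumer descending a non-negative `a′` uses this theorem instead of ★ D2 (one token) and reads `cone^±(ψ_M)(s) > 0` from
  ★ `integral_prod_conj_pos_of_nonneg` (p850271 §3: the `K × N` cone integral is positive once the integrand is non-zero AT THE VERTEX `s`).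
HONEST LABEL: HC_CM is proved only modulo the 7 printed citations (2 remaining named inputs: hLiu418 = `stmt-HodgeConjecture-24832`, h413 = `stmt-HodgeConjecture-24833`) until rung 0
closes; generic measure theory, count-neutral.

## References
* [Rogawski1990] J. D. Rogawski, *Automorphic Representations of Unitary Groups in Three Variables*, Ann. of Math. Stud. 123 (1990), §4.12 Lemma 4.12.1 p. 66 («`φ(m) = ∫ α(g) ϕ(g⁻¹ m δ₀ ε(g)) dg`
  … `φ` is smooth since `α` has compact support»), §8.2 p. 114.
* [HarishChandra1970] Harish-Chandra (notes by G. van Dijk), *Harmonic Analysis on Reductive p-adic Groups*, LNM 162 (1970), Part I §3, proof of Lemma 19 (the cut-off `α ≥ 0` with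
  `∫_M α(xm) dm = 1`), Lemmas 21–23.
* [Folland1995] G. B. Folland, *A Course in Abstract Harmonic Analysis* (1995), §2.6 Thm. 2.49.
-/

set_option autoImplicit false

noncomputable section

open MeasureTheory Topology Set Filter Function
open scoped Pointwise

namespace Literature.MeasureTheory.Group

/-! ## §1 The descent keeps real non-negativity -/

section Nonneg

variable {G : Type*} [Group G] [MeasurableSpace G] (ν : Measure G)

/-- A real non-negative cut-off times a real non-negative `ℂ`-valued function has a real non-negative Bochner integral: REAL PART `≥ 0`.
[cite: HarishChandra1970, Part I §3 (proof of Lemma 19)] [cite: Rogawski1990, §4.12 Lemma 4.12.1 p. 66] -/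
theorem re_integral_conj_nonneg {β : G → ℝ} (hβ0 : ∀ g, 0 ≤ β g) {ψ : G → ℂ} (hψ0 : ∀ g, 0 ≤ (ψ g).re ∧ (ψ g).im = 0) (m : G) :
    0 ≤ (∫ x, β x • ψ (x * m * x⁻¹) ∂ν).re := by
  -- `re ∫ = ∫ re` under integrability; the non-integrable case has integral `0`
  by_cases hint : Integrable (fun x => β x • ψ (x * m * x⁻¹)) ν
  · rw [← Complex.reCLM_apply, ← ContinuousLinearMap.integral_comp_comm Complex.reCLM hint]
    refine integral_nonneg fun x => ?_
    simp only [Complex.reCLM_apply, Complex.real_smul, Complex.mul_re, Complex.ofReal_re, Complex.ofReal_im, zero_mul, sub_zero]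
    exact mul_nonneg (hβ0 x) (hψ0 _).1
  · rw [integral_undef hint, Complex.zero_re]

/-- A real cut-off times a real `ℂ`-valued function has a real Bochner integral: IMAGINARY PART `= 0`.
[cite: HarishChandra1970, Part I §3 (proof of Lemma 19)] [cite: Rogawski1990, §4.12 Lemma 4.12.1 p. 66] -/
theorem im_integral_conj_eq_zero (β : G → ℝ) {ψ : G → ℂ} (hψ0 : ∀ g, 0 ≤ (ψ g).re ∧ (ψ g).im = 0) (m : G) :
    (∫ x, β x • ψ (x * m * x⁻¹) ∂ν).im = 0 := by
  by_cases hint : Integrable (fun x => β x • ψ (x * m * x⁻¹)) ν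
  · rw [← Complex.imCLM_apply, ← ContinuousLinearMap.integral_comp_comm Complex.imCLM hint]
    refine integral_eq_zero_of_ae (Filter.Eventually.of_forall fun x => ?_)
    simp only [Complex.imCLM_apply, Complex.real_smul, Complex.mul_im, Complex.ofReal_re, Complex.ofReal_im, zero_mul, add_zero, (hψ0 _).2, mul_zero, Pi.zero_apply]
  · rw [integral_undef hint, Complex.zero_im]

end Nonneg

/-! ## §2 Positivity of the descended function at a central point -/

section Pos

variable {G : Type*} [Group G] [TopologicalSpace G] [IsTopologicalGroup G] [MeasurableSpace G] [BorelSpace G]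
  (ν : Measure G) [ν.IsOpenPosMeasure] [IsFiniteMeasureOnCompacts ν]

/-- **POSITIVITY AT A CENTRAL POINT.**  `β ∈ C_c(G)`, `β ≥ 0` with `0 < β h₀` for some `h₀` COMMUTING with `m`; `ψ` continuous and real non-negative with `0 < re ψ(m)`.  Then
`0 < re ∫_G β(x) • ψ(x m x⁻¹) dν(x)` for any measure `ν` charging open sets (a Haar measure): the real integrand `x ↦ β(x)·re ψ(x m x⁻¹)` is continuous, non-negative, compactly
supported, and positive at `x = h₀` since `h₀ m h₀⁻¹ = m`. [cite: HarishChandra1970, Part I §3 Lemma 21] [cite: Rogawski1990, §4.12 Lemma 4.12.1 p. 66] -/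
theorem re_integral_conj_pos_of_comm {β : G → ℝ} (hβc : Continuous β) (hβs : HasCompactSupport β) (hβ0 : ∀ g, 0 ≤ β g)
    {ψ : G → ℂ} (hψc : Continuous ψ) (hψ0 : ∀ g, 0 ≤ (ψ g).re ∧ (ψ g).im = 0)
    {m h₀ : G} (hcomm : h₀ * m = m * h₀) (hh₀ : 0 < β h₀) (hm : 0 < (ψ m).re) :
    0 < (∫ x, β x • ψ (x * m * x⁻¹) ∂ν).re := by
  -- the real integrand
  set F : G → ℝ := fun x => β x * (ψ (x * m * x⁻¹)).re with hFdef
  have hFc : Continuous F := hβc.mul (Complex.continuous_re.comp (hψc.comp ((continuous_id.mul continuous_const).mul continuous_id.inv)))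
  have hFs : HasCompactSupport F := hβs.mul_right
  have hF0 : 0 ≤ F := fun x => mul_nonneg (hβ0 x) (hψ0 _).1
  have hFh₀ : F h₀ ≠ 0 := by
    have hconj : h₀ * m * h₀⁻¹ = m := by rw [hcomm, mul_inv_cancel_right]
    simp only [hFdef, hconj]
    exact (mul_pos hh₀ hm).ne'
  have hpos : 0 < ∫ x, F x ∂ν := hFc.integral_pos_of_hasCompactSupport_nonneg_nonzero hFs hF0 hFh₀
  -- integrability of the `ℂ`-valued integrand (continuous, compactly supported)
  have hIc : Continuous fun x => β x • ψ (x * m * x⁻¹) := hβc.smul (hψc.comp ((continuous_id.mul continuous_const).mul continuous_id.inv))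
  have hIs : HasCompactSupport fun x => β x • ψ (x * m * x⁻¹) := hβs.smul_right
  have hint : Integrable (fun x => β x • ψ (x * m * x⁻¹)) ν := hIc.integrable_of_hasCompactSupport hIs
  rw [← Complex.reCLM_apply, ← ContinuousLinearMap.integral_comp_comm Complex.reCLM hint]
  have hre : (fun x => Complex.reCLM (β x • ψ (x * m * x⁻¹))) = F := by
    funext x
    simp only [Complex.reCLM_apply, Complex.real_smul, Complex.mul_re, Complex.ofReal_re, Complex.ofReal_im, zero_mul, sub_zero, hFdef]
  rw [hre]
  exact hpos

end Pos

/-! ## §3 Uniform descent WITH the non-negativity and positivity handles -/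

section Uniform

variable {G : Type*} [Group G] [TopologicalSpace G] [IsTopologicalGroup G] [LocallyCompactSpace G] [SecondCountableTopology G]
  [T2Space G] [MeasurableSpace G] [BorelSpace G]

/-- **UNIFORM DESCENT NEAR A SEMI-REGULAR POINT, KEEPING NON-NEGATIVITY** — ★ D2 `exists_descended_forall_orbitalIntegral_eq` VERBATIM (same binders; the per-point identity
clause unchanged) with TWO MORE EXPORTS about the SAME descended function `ψ_M`: (iv) if `ψ` is real non-negative then so is `ψ_M`; (v) at every `m ∈ M` central IN `M` where
`0 < re ψ(m)` (and `ψ` real non-negative), `0 < re ψ_M(m)`.  Proof = D2's: Harish-Chandra's cut-off `β` for the compact `insert 1 C` (unit `M`-mass on `M` itself gives a point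
`h₀ ∈ M` with `0 < β h₀`), `ψ_M(m) := ∫ β(x) • ψ(x m x⁻¹) dν`, ★ `orbitalIntegral_eq_orbitalIntegral_descended` pointwise (its support hypothesis holds for the larger `C`), §1, §2.
[cite: Rogawski1990, §4.12 Lemma 4.12.1 p. 66; §8.2 p. 114] [cite: HarishChandra1970, Part I §3 Lemmas 19, 22–23] -/
theorem exists_descended_forall_orbitalIntegral_eq_nonneg
    (ν : Measure G) [ν.IsHaarMeasure] [ν.IsMulRightInvariant]
    (M : Subgroup G) (hM : IsClosed (M : Set G))
    (νM : Measure M) [νM.IsHaarMeasure] [νM.IsMulRightInvariant] [νM.IsInvInvariant]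
    {X : Type*} (c : X → M) {K : Set X}
    {ψ : G → ℂ} (hψc : Continuous ψ) (hψs : HasCompactSupport ψ)
    {C : Set G} (hC : IsCompact C) (hCM : ∀ x ∈ K, ∀ y : G, y * ((c x : M) : G) * y⁻¹ ∈ tsupport ψ → y ∈ C * (M : Set G)) :
    ∃ ψM : M → ℂ, Continuous ψM ∧ HasCompactSupport ψM ∧
      (∀ x ∈ K,
        ∀ [hT : IsClosed ((Subgroup.centralizer ({((c x : M) : G)} : Set G) : Subgroup G) : Set G)]
          [hT' : IsClosed ((Subgroup.centralizer ({c x} : Set M) : Subgroup M) : Set M)]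
          [MeasurableSpace (G ⧸ Subgroup.centralizer ({((c x : M) : G)} : Set G))] [BorelSpace (G ⧸ Subgroup.centralizer ({((c x : M) : G)} : Set G))]
          [MeasurableSpace (M ⧸ Subgroup.centralizer ({c x} : Set M))] [BorelSpace (M ⧸ Subgroup.centralizer ({c x} : Set M))]
          (νT : Measure (Subgroup.centralizer ({((c x : M) : G)} : Set G))) [νT.IsHaarMeasure] [νT.IsMulRightInvariant] [νT.IsInvInvariant]
          (νT' : Measure (Subgroup.centralizer ({c x} : Set M))) [νT'.IsHaarMeasure] [νT'.IsInvInvariant],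
          νT = Measure.map (fun s : Subgroup.centralizer ({c x} : Set M) =>
            (⟨((s : M) : G), Subgroup.mem_centralizer_singleton_iff.2 (by
              have h := Subgroup.mem_centralizer_singleton_iff.1 s.2
              exact_mod_cast congrArg ((↑) : M → G) h)⟩ : Subgroup.centralizer ({((c x : M) : G)} : Set G))) νT' →
          IsClosed {g : G | ∃ y : G, y * ((c x : M) : G) * y⁻¹ = g} →
            Literature.NumberTheory.Automorphic.orbitalIntegral ((c x : M) : G) ψ
                (quotientMeasure (Subgroup.centralizer ({((c x : M) : G)} : Set G)) νT hT ν) =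
              Literature.NumberTheory.Automorphic.orbitalIntegral (c x) ψM
                (quotientMeasure (Subgroup.centralizer ({c x} : Set M)) νT' hT' νM)) ∧
      ((∀ g, 0 ≤ (ψ g).re ∧ (ψ g).im = 0) → ∀ m : M, 0 ≤ (ψM m).re ∧ (ψM m).im = 0) ∧
      (∀ m : M, (∀ h : M, h * m = m * h) → (∀ g, 0 ≤ (ψ g).re ∧ (ψ g).im = 0) → 0 < (ψ (m : G)).re → 0 < (ψM m).re) := by
  -- ONE cut-off `β` of unit `M`-mass on `(insert 1 C) · M`
  have hC1 : IsCompact (insert (1 : G) C) := hC.insert 1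
  obtain ⟨β, hβc, hβs, hβ0, hβ1⟩ := exists_continuous_hasCompactSupport_integral_comp_mul_eq_one M hM νM hC1
  -- the support hypothesis survives the enlargement of `C`
  have hCM1 : ∀ x ∈ K, ∀ y : G, y * ((c x : M) : G) * y⁻¹ ∈ tsupport ψ → y ∈ insert (1 : G) C * (M : Set G) := fun x hx y hy =>
    Set.mul_subset_mul_right (Set.subset_insert _ _) (hCM x hx y hy)
  -- a point of `M` where `β` is positive (unit mass on the coset `M`)
  have hmass : ∫ h : M, β (h : G) ∂νM = 1 := by
    simpa only [one_mul, OneMemClass.coe_one] using hβ1 1 (Set.mem_insert 1 C) 1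
  have hh₀ : ∃ h₀ : M, 0 < β (h₀ : G) := by
    by_contra hneg
    have hzero : (fun h : M => β (h : G)) = fun _ => (0 : ℝ) :=
      funext fun h => le_antisymm (not_lt.1 fun hlt => hneg ⟨h, hlt⟩) (hβ0 _)
    rw [hzero, integral_zero] at hmass
    exact zero_ne_one hmass
  obtain ⟨h₀, hh₀⟩ := hh₀
  refine ⟨fun m : M => ∫ x, β x • ψ (x * (m : G) * x⁻¹) ∂ν, continuous_integral_conj_subtype ν M hβc hβs hψc,
    hasCompactSupport_integral_conj ν M hM hβs hψs, ?_, ?_, ?_⟩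
  · intro x hx hT hT' _ _ _ _ νT _ _ _ νT' _ _ hνT hO
    exact orbitalIntegral_eq_orbitalIntegral_descended ν M hM νM (c x) νT νT' hνT hO hβc hβs hβ0 hβ1 hψc hψs (hCM1 x hx)
  · intro hψ0 m
    exact ⟨re_integral_conj_nonneg ν hβ0 hψ0 (m : G), im_integral_conj_eq_zero ν β hψ0 (m : G)⟩
  · intro m hcen hψ0 hm
    have hcomm : (h₀ : G) * (m : G) = (m : G) * (h₀ : G) := by exact_mod_cast hcen h₀
    exact re_integral_conj_pos_of_comm ν hβc hβs hβ0 hψc hψ0 hcomm hh₀ hm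

end Uniform

end Literature.MeasureTheory.Group

end
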